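import Mathlib
import HarnessLib
import Summits.NavierStokesRegularity.NavierStokesRegularity.Theorems.PoloidalWindowDoorPoloidalWindowRigidityZShockPSystemLiouville

/-!
# Crux K2 `PoloidalWindowRigidity` (stmt-NavierStokesRegularity-19708), line `z_shock` — RUNG R2 RE-LANDED IN SATISFIABLE FORM:
# the two-sided Liouville theorem for the autonomous genuinely nonlinear p-system with the bounds on `κ, κ'` taken ALONG THE SOLUTION

`--supports stmt-NavierStokesRegularity-19708 --as helper` (decomp-ns census instrument g26, 2026-08-31; repair named by the cell critic,
CRITIC-LEDGER rows 310/311). Class-free, Mathlib + the leaf hand's tree file only. **No stub and no summit is closed by this file;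
Navier–Stokes regularity is NOT proved here (rung 0).**

WHY THIS FILE. The leaf hand's `…ZShockPSystemLiouville.pSystem_derivs_eq_zero` / `pSystem_const` (p796350) and the sign twins in
`…PSystemLiouvilleNeg` (p796702) state the bounds `κlo ≤ κ ≤ κhi`, `|κ'| ≤ k₁` and the genuine nonlinearity `κ' ≥ k₀ > 0` for ALL
`v : ℝ`; a function on `ℝ` with derivative `≥ k₀ > 0` everywhere is unbounded, so those premise lists are jointly unsatisfiable and the
theorems hold of nothing (critic OBJECTION row 310, kernel probe; census by-import twin `PSystemVacuity_byImport_probe_g26`). The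
mechanism, however, only ever evaluates `κ, κ'` at values `w q` of the solution. This file re-lands R2 with the four bounds stated
ALONG THE SOLUTION — `∀ q, κlo ≤ κ (w q) ≤ κhi`, `∀ q, k₀ ≤ κ' (w q)`, `∀ q, |κ' (w q)| ≤ k₁` — exactly as the non-vacuous sister
`…ZShockRiemannInvariantLiouville.riemannInvariant_const` (p796046) does; these are SATISFIABLE (e.g. any bounded `w` and a smooth
`κ` that is increasing with positive bounds on `[inf w, sup w]`), and they are what a bounded eternal solution of a genuinely nonlinear
p-system actually provides. The proof is the hand's, verbatim up to the binder change (Riemann invariants `r, s = p ± K(w)`; global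
`±κ(w)`-characteristics from `…ZShockGlobalCharacteristics.exists_global_solution`; Lax's identity `transversal_deriv_along_of_speed`;
John's weight `½ log κ(w)`; the damped two-sided Riccati lemma; `transversal_eq_zero_of_split`), all imported from the tree.

* `pSystem_derivs_eq_zero_along` — all four first derivatives of `(w, p)` vanish identically;
* `pSystem_const_along` — **R2**: `(w, p)` is a constant state.

[folklore] (Lax 1964 (2.6); John 1974; the card `Cruxes/PoloidalWindowRigidity/Lines/z_shock.md` §R2)
-/

noncomputable section

-- the summit and its single sub-problem share the name (CONVENTIONS §1), as in every Theorems file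
set_option linter.dupNamespace false

open Set Filter Topology Function Metric
open scoped NNReal

namespace Summit.NavierStokesRegularity.NavierStokesRegularity.Theorems.PoloidalWindowDoorPoloidalWindowRigidityZShockPSystemLiouvilleAlong

open Summit.NavierStokesRegularity.NavierStokesRegularity.Theorems.PoloidalWindowDoorPoloidalWindowRigidityZShockPSystemLiouville
open Summit.NavierStokesRegularity.NavierStokesRegularity.Theorems.PoloidalWindowDoorPoloidalWindowRigidityZShockRiccatiTwoSided
open Summit.NavierStokesRegularity.NavierStokesRegularity.Theorems.PoloidalWindowDoorPoloidalWindowRigidityZShockCharacteristicRiccati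
open Summit.NavierStokesRegularity.NavierStokesRegularity.Theorems.PoloidalWindowDoorPoloidalWindowRigidityZShockGlobalCharacteristics

/-- **Two-sided Liouville for the autonomous genuinely nonlinear p-system, bounds along the solution** (`p_z = −κ(w)² w_x`,
`w_z = −p_x` on all of `ℝ × ℝ`; `w, p ∈ C²`; `w_x` bounded; `0 < κlo ≤ κ(w q) ≤ κhi`, `k₀ ≤ κ'(w q)`, `|κ'(w q)| ≤ k₁` for every
point `q`): `∂_x w ≡ 0`, `∂_x p ≡ 0`, `∂_z w ≡ 0`, `∂_z p ≡ 0`. [folklore] -/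
theorem pSystem_derivs_eq_zero_along {w p : ℝ × ℝ → ℝ} {κ κ' K : ℝ → ℝ} (hw : ContDiff ℝ 2 w) (hp : ContDiff ℝ 2 p)
    (hK2 : ContDiff ℝ 2 K) (hKd : ∀ v, HasDerivAt K (κ v) v) (hκd : ∀ v, HasDerivAt κ (κ' v) v)
    (hsys1 : ∀ q, fderiv ℝ p q (1, 0) = -(κ (w q) ^ 2 * fderiv ℝ w q (0, 1)))
    (hsys2 : ∀ q, fderiv ℝ w q (1, 0) = -fderiv ℝ p q (0, 1))
    {κlo κhi k₀ k₁ W₁ : ℝ} (hκlo0 : 0 < κlo) (hκlo : ∀ q, κlo ≤ κ (w q)) (hκhi : ∀ q, κ (w q) ≤ κhi)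
    (hk₀ : 0 < k₀) (hgnl : ∀ q, k₀ ≤ κ' (w q)) (hk₁ : ∀ q, |κ' (w q)| ≤ k₁) (hW₁ : ∀ q, |fderiv ℝ w q (0, 1)| ≤ W₁) :
    ∀ q : ℝ × ℝ, fderiv ℝ w q (0, 1) = 0 ∧ fderiv ℝ p q (0, 1) = 0 ∧
      fderiv ℝ w q (1, 0) = 0 ∧ fderiv ℝ p q (1, 0) = 0 := by
  have hw1 : Differentiable ℝ w := hw.differentiable (by simp)
  have hp1 : Differentiable ℝ p := hp.differentiable (by simp)
  have hκ1 : Differentiable ℝ κ := fun v => (hκd v).differentiableAt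
  have hκpos : ∀ q, 0 < κ (w q) := fun q => hκlo0.trans_le (hκlo q)
  have hκhi0 : 0 < κhi := hκlo0.trans_le ((hκlo 0).trans (hκhi 0))
  -- Riemann invariants
  set r : ℝ × ℝ → ℝ := fun q => p q + K (w q) with hrdef
  set s : ℝ × ℝ → ℝ := fun q => p q - K (w q) with hsdef
  have hr2 : ContDiff ℝ 2 r := hp.add (hK2.comp hw)
  have hs2 : ContDiff ℝ 2 s := hp.sub (hK2.comp hw)
  have hKw : ∀ q, HasFDerivAt (fun q' => K (w q')) (κ (w q) • fderiv ℝ w q) q :=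
    fun q => (hKd (w q)).comp_hasFDerivAt q (hw1 q).hasFDerivAt
  have hrF : ∀ q, HasFDerivAt r (fderiv ℝ p q + κ (w q) • fderiv ℝ w q) q :=
    fun q => (hp1 q).hasFDerivAt.add (hKw q)
  have hsF : ∀ q, HasFDerivAt s (fderiv ℝ p q - κ (w q) • fderiv ℝ w q) q :=
    fun q => (hp1 q).hasFDerivAt.sub (hKw q)
  have hrD : ∀ q v, fderiv ℝ r q v = fderiv ℝ p q v + κ (w q) * fderiv ℝ w q v := by
    intro q v
    rw [(hrF q).fderiv]
    simp [smul_eq_mul]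
  have hsD : ∀ q v, fderiv ℝ s q v = fderiv ℝ p q v - κ (w q) * fderiv ℝ w q v := by
    intro q v
    rw [(hsF q).fderiv]
    simp [smul_eq_mul]
  -- the two speeds and the diagonal equations
  set c₁ : ℝ × ℝ → ℝ := fun q => κ (w q) with hc₁
  set c₂ : ℝ × ℝ → ℝ := fun q => -κ (w q) with hc₂
  have hκw : ∀ q, HasFDerivAt (fun q' => κ (w q')) (κ' (w q) • fderiv ℝ w q) q :=
    fun q => (hκd (w q)).comp_hasFDerivAt q (hw1 q).hasFDerivAt
  have hc₁d : Differentiable ℝ c₁ := fun q => (hκw q).differentiableAt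
  have hc₂d : Differentiable ℝ c₂ := fun q => (hκw q).neg.differentiableAt
  have hc₁x : ∀ q, fderiv ℝ c₁ q (0, 1) = κ' (w q) * fderiv ℝ w q (0, 1) := by
    intro q; rw [hc₁, (hκw q).fderiv]; simp [smul_eq_mul]
  have hc₂F : ∀ q, HasFDerivAt c₂ (-(κ' (w q) • fderiv ℝ w q)) q := fun q => (hκw q).neg
  have hc₂x : ∀ q, fderiv ℝ c₂ q (0, 1) = -(κ' (w q) * fderiv ℝ w q (0, 1)) := by
    intro q; rw [(hc₂F q).fderiv]; simp [smul_eq_mul]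
  have hPDE1 : ∀ q, fderiv ℝ r q (1, 0) + c₁ q * fderiv ℝ r q (0, 1) = 0 := by
    intro q; rw [hrD, hrD, hc₁, hsys1, hsys2]; ring
  have hPDE2 : ∀ q, fderiv ℝ s q (1, 0) + c₂ q * fderiv ℝ s q (0, 1) = 0 := by
    intro q; rw [hsD, hsD, hc₂, hsys1, hsys2]; ring
  -- global characteristics for both speeds
  have hW₁0 : 0 ≤ W₁ := (abs_nonneg _).trans (hW₁ 0)
  have hk₁0 : 0 ≤ k₁ := (abs_nonneg _).trans (hk₁ 0)
  have hchar : ∀ σ : ℝ, (σ = 1 ∨ σ = -1) → ∀ z₀ x₀ : ℝ, ∃ X : ℝ → ℝ, X z₀ = x₀ ∧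
      ∀ z, HasDerivAt X (σ * κ (w (z, X z))) z := by
    intro σ hσ z₀ x₀
    have hσ1 : |σ| = 1 := by rcases hσ with h | h <;> simp [h]
    have hsl : ∀ z x, HasDerivAt (fun x' => σ * κ (w (z, x'))) (σ * (κ' (w (z, x)) * fderiv ℝ w (z, x) (0, 1))) x := by
      intro z x
      have hγ : HasDerivAt (fun x' : ℝ => ((z, x') : ℝ × ℝ)) ((0 : ℝ), (1 : ℝ)) x :=
        (hasDerivAt_const x z).prodMk (hasDerivAt_id x)
      have h1 : HasDerivAt (fun x' => κ (w (z, x'))) ((κ' (w (z, x)) • fderiv ℝ w (z, x)) ((0 : ℝ), (1 : ℝ))) x :=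
        (hκw (z, x)).comp_hasDerivAt x hγ
      have h2 := h1.const_mul σ
      simpa [smul_eq_mul] using h2
    refine exists_global_solution (F := fun z x => σ * κ (w (z, x))) (K := Real.toNNReal (k₁ * W₁))
      (B := Real.toNNReal κhi) (fun z => ?_) (fun x => ?_) (fun z x => ?_) z₀ x₀
    · refine lipschitzWith_of_nnnorm_deriv_le (fun x => (hsl z x).differentiableAt) fun x => ?_
      rw [(hsl z x).deriv, ← NNReal.coe_le_coe, coe_nnnorm, Real.coe_toNNReal _ (mul_nonneg hk₁0 hW₁0),
        Real.norm_eq_abs, abs_mul, hσ1, one_mul, abs_mul]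
      exact mul_le_mul (hk₁ _) (hW₁ _) (abs_nonneg _) hk₁0
    · exact continuous_const.mul (hκ1.continuous.comp (hw1.continuous.comp (continuous_id.prodMk continuous_const)))
    · rw [Real.norm_eq_abs, abs_mul, hσ1, one_mul, abs_of_pos (hκpos _), Real.coe_toNNReal _ hκhi0.le]
      exact hκhi _
  -- John's weight `h = ½ log κ(w)` along a curve, and the bounds
  set H : ℝ := (|Real.log κlo| + |Real.log κhi|) / 2 with hHdef
  have hlogbd : ∀ q, |Real.log (κ (w q)) / 2| ≤ H := by
    intro q
    have h1 : Real.log κlo ≤ Real.log (κ (w q)) := Real.log_le_log hκlo0 (hκlo q)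
    have h2 : Real.log (κ (w q)) ≤ Real.log κhi := Real.log_le_log (hκpos q) (hκhi q)
    rw [abs_div, abs_two, hHdef]
    have : |Real.log (κ (w q))| ≤ |Real.log κlo| + |Real.log κhi| := by
      rcases le_total 0 (Real.log (κ (w q))) with h0 | h0
      · rw [abs_of_nonneg h0]; linarith [le_abs_self (Real.log κhi), abs_nonneg (Real.log κlo)]
      · rw [abs_of_nonpos h0]; linarith [neg_abs_le (Real.log κlo), abs_nonneg (Real.log κhi)]
    linarith
  set a₀ : ℝ := k₀ / (2 * κhi) with ha₀def
  have ha₀ : 0 < a₀ := by positivity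
  have habd : ∀ q, a₀ ≤ κ' (w q) / (2 * κ (w q)) := by
    intro q
    rw [ha₀def, div_le_div_iff₀ (by positivity) (by linarith [hκpos q])]
    have := hgnl q; have := hκhi q; have := hκpos q
    nlinarith
  -- derivative of `w` along a `σκ`-characteristic, and the John weight
  have halong : ∀ (σ : ℝ) (X : ℝ → ℝ), (∀ z, HasDerivAt X (σ * κ (w (z, X z))) z) → ∀ z,
      HasDerivAt (fun t => Real.log (κ (w (t, X t))) / 2)
        (κ' (w (z, X z)) * (fderiv ℝ w (z, X z) (1, 0) + σ * κ (w (z, X z)) * fderiv ℝ w (z, X z) (0, 1)) /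
          (2 * κ (w (z, X z)))) z := by
    intro σ X hX z
    have hwz := hasDerivAt_along (F := w) (hw1 (z, X z)) (hX z)
    have hκz := (hκd (w (z, X z))).comp z hwz
    have hκne : κ (w (z, X z)) ≠ 0 := (hκpos _).ne'
    have hlog := (hκz.log hκne).div_const 2
    refine hlog.congr_deriv ?_
    simp only [Function.comp_apply]
    field_simp
  intro q
  obtain ⟨z₀, x₀⟩ := q
  -- r-family: speed `κ(w)`
  obtain ⟨X₁, hX₁0, hX₁⟩ := hchar 1 (Or.inl rfl) z₀ x₀
  have hX₁' : ∀ z, HasDerivAt X₁ (c₁ (z, X₁ z)) z := fun z => by simpa [hc₁] using hX₁ z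
  have hr0 : ∀ z, fderiv ℝ r (z, X₁ z) (0, 1) = 0 := by
    refine transversal_eq_zero_of_split hr2 hc₁d hPDE1 hX₁' ha₀
      (a := fun z => κ' (w (z, X₁ z)) / (2 * κ (w (z, X₁ z)))) (fun z => habd _)
      (h := fun t => Real.log (κ (w (t, X₁ t))) / 2) (fun z => hlogbd _) (halong 1 X₁ hX₁) fun z => ?_
    rw [hc₁x, hrD, hsys2]
    have hκne : κ (w (z, X₁ z)) ≠ 0 := (hκpos _).ne'
    field_simp
    ring
  -- s-family: speed `-κ(w)`
  obtain ⟨X₂, hX₂0, hX₂⟩ := hchar (-1) (Or.inr rfl) z₀ x₀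
  have hX₂' : ∀ z, HasDerivAt X₂ (c₂ (z, X₂ z)) z := fun z => by simpa [hc₂] using hX₂ z
  have hs0 : ∀ z, fderiv ℝ s (z, X₂ z) (0, 1) = 0 := by
    refine transversal_eq_zero_of_split hs2 hc₂d hPDE2 hX₂' ha₀
      (a := fun z => κ' (w (z, X₂ z)) / (2 * κ (w (z, X₂ z)))) (fun z => habd _)
      (h := fun t => Real.log (κ (w (t, X₂ t))) / 2) (fun z => hlogbd _) (halong (-1) X₂ hX₂) fun z => ?_
    rw [hc₂x, hsD, hsys2]
    have hκne : κ (w (z, X₂ z)) ≠ 0 := (hκpos _).ne'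
    field_simp
    ring
  -- at the base point
  have h1 := hr0 z₀
  have h2 := hs0 z₀
  rw [hX₁0] at h1
  rw [hX₂0] at h2
  rw [hrD] at h1
  rw [hsD] at h2
  have hκne : κ (w (z₀, x₀)) ≠ 0 := (hκpos _).ne'
  have hwx : fderiv ℝ w (z₀, x₀) (0, 1) = 0 := by
    have : 2 * κ (w (z₀, x₀)) * fderiv ℝ w (z₀, x₀) (0, 1) = 0 := by linear_combination h1 - h2
    rcases mul_eq_zero.1 this with h | h
    · exact absurd h (mul_ne_zero two_ne_zero hκne)
    · exact h
  have hpx : fderiv ℝ p (z₀, x₀) (0, 1) = 0 := by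
    have : 2 * fderiv ℝ p (z₀, x₀) (0, 1) = 0 := by linear_combination h1 + h2
    linarith
  refine ⟨hwx, hpx, ?_, ?_⟩
  · rw [hsys2, hpx, neg_zero]
  · rw [hsys1, hwx, mul_zero, neg_zero]

/-- **R2 (constancy), satisfiable form.** Under the hypotheses of `pSystem_derivs_eq_zero_along` (bounds on `κ, κ'` along the
solution), the two-sided eternal solution `(w, p)` of the autonomous genuinely nonlinear p-system is a CONSTANT STATE. [folklore] -/
theorem pSystem_const_along {w p : ℝ × ℝ → ℝ} {κ κ' K : ℝ → ℝ} (hw : ContDiff ℝ 2 w) (hp : ContDiff ℝ 2 p)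
    (hK2 : ContDiff ℝ 2 K) (hKd : ∀ v, HasDerivAt K (κ v) v) (hκd : ∀ v, HasDerivAt κ (κ' v) v)
    (hsys1 : ∀ q, fderiv ℝ p q (1, 0) = -(κ (w q) ^ 2 * fderiv ℝ w q (0, 1)))
    (hsys2 : ∀ q, fderiv ℝ w q (1, 0) = -fderiv ℝ p q (0, 1))
    {κlo κhi k₀ k₁ W₁ : ℝ} (hκlo0 : 0 < κlo) (hκlo : ∀ q, κlo ≤ κ (w q)) (hκhi : ∀ q, κ (w q) ≤ κhi)
    (hk₀ : 0 < k₀) (hgnl : ∀ q, k₀ ≤ κ' (w q)) (hk₁ : ∀ q, |κ' (w q)| ≤ k₁) (hW₁ : ∀ q, |fderiv ℝ w q (0, 1)| ≤ W₁) :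
    ∀ q q' : ℝ × ℝ, w q = w q' ∧ p q = p q' := by
  have hall := pSystem_derivs_eq_zero_along hw hp hK2 hKd hκd hsys1 hsys2 hκlo0 hκlo hκhi hk₀ hgnl hk₁ hW₁
  have hw1 : Differentiable ℝ w := hw.differentiable (by simp)
  have hp1 : Differentiable ℝ p := hp.differentiable (by simp)
  have hDw : ∀ q, fderiv ℝ w q = 0 := fun q => by
    refine ContinuousLinearMap.ext fun v => ?_
    obtain ⟨a, b⟩ := v
    rw [Literature.Geometry.Riemannian.clm_prod_apply_eq, (hall q).1, (hall q).2.2.1]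
    simp
  have hDp : ∀ q, fderiv ℝ p q = 0 := fun q => by
    refine ContinuousLinearMap.ext fun v => ?_
    obtain ⟨a, b⟩ := v
    rw [Literature.Geometry.Riemannian.clm_prod_apply_eq, (hall q).2.1, (hall q).2.2.2]
    simp
  intro q q'
  exact ⟨is_const_of_fderiv_eq_zero hw1 hDw q q', is_const_of_fderiv_eq_zero hp1 hDp q q'⟩

end Summit.NavierStokesRegularity.NavierStokesRegularity.Theorems.PoloidalWindowDoorPoloidalWindowRigidityZShockPSystemLiouvilleAlong
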